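import Mathlib
import Literature.MathematicalPhysics.QuantumFieldTheory.Balaban1983to89.B6Ineq249Proof

/-!
# `Balaban1983to89.B6Ineq266Proof` — T. Bałaban, *Propagators and renormalization transformations for lattice gauge
theories. II*, Commun. Math. Phys. **96** (1984) 223–250 [Balaban1984PropagatorsII]: the chain **(2.64)–(2.66)** and the
first entry of **Proposition 2.2 (2.67)**, `|(G′λ)(x)| ≤ O(1)(L^jη)²e^{−½δ₀d(y,y′)}|λ|`, ASSEMBLED from the printed local
inputs (2.36)–(2.38), (2.43), (2.44) and Lemma 2.1, and PROVED OUTRIGHT on the printed one-level cube cover (the box model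
of `B6CoverBox`), where every geometric hypothesis of the chain is discharged

statement-level skeleton of published theorems with citation tags; proofs where landed; nothing here is a claim about the Yang–Mills mass gap.
PDF held: `paper:balaban1984-cmp96-propagators-rt-ii` (journal page = PDF page + 222); pp. 229–234 [PDF 7–12] read this
session (`lit read paper:balaban1984-cmp96-propagators-rt-ii --pages 8-12` and the ×2 renders `run/shared/lean/pub/
pub-balaban/b2b-balaban-ref1/pages/1984-cmp96-propagators-rt-II/1984-cmp96-propagators-rt-II-p008-x2.png`, `…-p012-x2.png`).

CITATION HEADER (cell `lit-balaban`, Phase-2 proof seat `p01` (gen 2) = unit `lit-balaban-p01`, HOME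
`run/shared/lean/pub/lit-balaban/` (`PHASE2-TARGETS.md` §G, ruling G.5-34(d)); SKELETON rows **`B6.Eq2.64`** ((2.64)–(2.66)
p. 234) and **`B6.Prop2.2`** (the FIRST entry of (2.67), kind «model-instance» on the printed cover); companion of this
seat's `…B6Ineq249Proof` (rows B6.Eq2.49 / B6.Eq2.51, p243144 / p243405), which is IMPORTED, not modified).  Reused BY
NAME, nothing restated: `B6Eq250.gZero/rOp/aTerm/bTerm/left_inverse_mul_one_sub` ((2.37)/(2.38), reader r03 p241200),
`B6Ineq249Proof.hasMajorant_sum_of_244` / `hasMajorant251_of_244` ((2.38) + (2.44) ⇒ (2.51)),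
`B6Prop23Chain.majorant_pow_265W` / `majorant_of_fixedPoint_266W` (the kernel-checked chain (2.52) ⇒ (2.64) ⇒ (2.65) ⇒
(2.66) of units pv08 / b06 with a GENERIC (2.61)-constant c), `B6Prop23Chain.hasMajorant_id_iff` / `blockSupp_single`
(block form ↔ matrix entries), `B6CoverBox.boxGeo/hprof/Kbox/sum_hprof_sq/card_filter_hprof_ne_zero_le/boxGeo_triangle/
boxGeo_ineq261With/boxGeo_ineq263With` (the coordinatised cover 𝒟 / {h_□} of (2.36) and its (2.54)/(2.61)′/(2.63)′
binders, unit b06-g17).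
WHAT THE PAPER PRINTS (p. 234 [PDF 12], verbatim): *"From the lemma and (2.55) we get |(Rλ)(x)| ≤ O(1)ⁿc₁ⁿe^{−½δ₀d(y,y′)}|λ|,
x ∈ B^j(y), supp λ ⊂ B^{j′}(y′). (2.64) Applying this inequality to the nth power of the operator R in (2.38) we have
|(Rⁿλ)(x)| ≤ (O(M⁻¹)c₁)ⁿe^{−½δ₀d(y,y′)}|λ|, (2.65) and this implies finally for x ∈ B^j(y), supp λ ⊂ B^{j′}(y′),
|(G′λ)(x)| ≤ Σ_{n=0}^∞ |(G′₀Rⁿλ)(x)| ≤ O(1)(L^jη)² Σ_{y″:(L^jη)⁻¹|y−y″|≤2dM} e^{−δ₀(L^jη)⁻¹|y−y″|}·Σ_{n=0}^∞ (O(M⁻¹)c₁)ⁿ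
e^{−½δ₀d(y″,y′)}|λ| ≤ O(1)(L^jη)²e^{−½δ₀d(y,y′)}|λ|. (2.66) … Proposition 2.2. If we have (2.1), (2.2) and M is
sufficiently large, then the operator G′ = Δ′_a⁻¹ (a = 1) satisfies the inequalities |(G′λ)(x)|, |(∇G′λ)(x)|, … ≤
O(1)[(L^jη)², L^jη, …]e^{−½δ₀d(y,y′)}|λ|, x ∈ B^j(y) …, y ∈ Λ_j, supp λ ⊂ B^{j′}(y′), y′ ∈ Λ_{j′}. (2.67) The random walk
representation (2.50) is convergent in the norms defined by these inequalities."*  The inputs, verbatim: (2.37)/(2.38)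
p. 229 *"G′₀ = Σ_□ h_□G′(□)h_□ … Δ′_aG′₀ = I − Σ_□ K(h_□)G′(□)h_□ = I − R"*; (2.36) *"Σ_{□∈𝒟} h_□² = 1"*; (2.43) p. 230
*"|(G′(□)λ)(x)|, |(∂^{L^{−j}}_μG′(□)λ)(x)| ≤ O(1)e^{−δ₀dist(x,supp λ)}|λ|"*; (2.44) *"|(K(h_□)G′(□)h_□λ)(x)| ≤
O(M⁻¹)e^{−δ₀|x−y|}|λ| if either supp λ ⊂ B^j(y) for y ∈ Λ_j, or supp λ ⊂ B^{j+1}(y) for y ∈ Λ_{j+1}"*; Lemma 2.1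
(2.61)/(2.63) p. 234.
WHAT IS PROVED HERE (0 sorry, 0 new definitions, 0 named facts; every analytic input is a hypothesis OF THE PRINTED SHAPE):
§1 over an ABSTRACT multiscale lattice `X` with block map `blk : X → 𝔅` into any `B6.Geometry`, a finite cover `ι` and
  operators in `Module.End ℝ (X → ℝ)`: `hasMajorant_gZero_of_243` ((2.37) + the (2.43)-shape bound of each sandwiched
  term h_□G′(□)h_□ on the blocks met by its cube + locality of the h_□ (≤ n₀ cubes per block) ⇒ G′₀ has the majorant
  n₀A·P(y)e^{−δ₀d(y,y′)} — the "O(1)(L^jη)² Σ_{y″} e^{−δ₀…}" factor of (2.66)); `hasMajorant_rOp_of_244` ((2.38) + (2.44)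
  ⇒ the (2.51)/(2.64) majorant n₀θe^{−δ₀d} of R); `fixedPoint_of_238` ((2.36) + local inverses + G′Δ′_a = I ⇒
  G′ = G′₀ + G′R, the algebra of (2.50)); `pow_majorant265_of_244` (**(2.65)**: Rᴺ has the majorant (n₀θc)ᴺe^{−(1−α)δ₀d});
  **`hasMajorant266_of_243_244`** (all of these + Lemma 2.1 in the generic-constant form (2.61)′/(2.63)′ with constant c
  + the located smallness n₀θc < 1 ⇒ **G′ has the majorant n₀Ac(1 − n₀θc)⁻¹·P(y)·e^{−(1−α)δ₀d(y,y′)}** — (2.66), i.e.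
  the first entry of (2.67), with its O(1) explicit).
§2 the MODEL INSTANCE on the printed cover, one level (p. 235 *"Λ_j scaled to unit lattice"*), for an ARBITRARY fine
  lattice `X` over the box 𝔅 = {0,…,nM}^d of `B6CoverBox.boxGeo` (cubes □_k of side 2M centred on the M-lattice, 2^d-fold
  overlap) with the cut-offs h_k = multiplication by `hprof m k ∘ blk` (h_k(x) = Π_μ h((x_μ − k_μM)/M), [B5] (1.118)):
  `box_sum_h_mul_h` ((2.36) as the operator identity Σ_kh_kh_k = I), `box_pow_majorant265` ((2.65) on the model),
  **`box_hasMajorant266_of_243_244`** — from the block-form (2.43)/(2.44) bounds with rate δ₀, G′Δ′_a = I, the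
  local-inverse property h_kΔ′_aG′(□_k)h_k = h_kh_k, 0 < αδ₀, 0 ≤ δ₀, α ≤ 1 and 2^dθK(αδ₀) < 1 (K(a) = (2(1 − e^{−a})⁻¹)^d
  = `Kbox d a`, the volume-independent (2.61)-constant of the ℓ¹ box sums): **G′ has the majorant
  2^dA·K(αδ₀)·(1 − 2^dθK(αδ₀))⁻¹·P(y)·e^{−(1−α)δ₀|y−y′|₁}**, with (2.36), the overlap number 2^d, (2.54), (2.61)′, (2.63)′,
  d(y,y) = 0, d ≥ 0 ALL DISCHARGED; `box_hG_of_243_244` (P(y) = (L^jη)²: the conclusion is VERBATIM the input `hG` of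
  `B6CoverBox.prop23_assembled_box` — Proposition 2.3's use of (2.67) on this model is thereby fed by (2.43)/(2.44));
  `box_kernel266_of_243_244` (blocks = sites, matrix form: |G′(□_k)(x,y)| ≤ Ae^{−δ₀|x−y|₁} and |(K(h_k)G′(□_k)h_k)(x,y)| ≤
  θe^{−δ₀|x−y|₁} for all k ⇒ |G′(x,y)| ≤ 2^dAK(αδ₀)(1 − 2^dθK(αδ₀))⁻¹e^{−(1−α)δ₀|x−y|₁}).
NOT proved here (inputs, exactly as in print): (2.43) itself (from (2.41)–(2.42) and Lemmas 2.2, 2.4, Prop. 2.3 of [3] =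
B5) and (2.44) (row `B6.Eq2.44`); the existence of Δ′_a⁻¹ (positivity (2.11)); the five derivative / Hölder / Laplacian
entries of (2.67) and the Hölder-norm convergence clause; multi-level covers in the model (§1 treats them abstractly — the
printed constant c₁(α) = 12c₀(½α)^d of Lemma 2.1 is refuted as typed, `B6Lemma21Counterexample` (d ≥ 3) and
`B6Lemma21TwoDim`/`…Refutation`/`…TowerD2` (d = 2), whence the GENERIC constant c of (2.61)′/(2.63)′, cell GAPS G-A11-1 /
G-A12-1); the comparison of the euclidean (L^jη)⁻¹|y − y″| ≤ 2dM of (2.66) with d inside one cube (located, G-pv08-2; on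
one level both are the ℓ¹ lattice distance, dictionary D-pv08g2.1 of `B6BoxCharts`, so nothing is lost in §2).  Rate
bookkeeping: print takes α = ½ ((1 − α)δ₀ = ½δ₀, c₁ = c₁(½)); here α is a free parameter in ]0, 1].  COMPANION
(same seat): `…B6Ineq244BoxProof` proves the INPUT (2.44) from (2.43) on this model (blocks = sites) — the commutator
K(h_□) is O(M⁻¹) because h_□ varies on the scale M — and closes the chain as "(2.43) alone ⇒ (2.66)" there.
-/

namespace Literature.MathematicalPhysics.QuantumFieldTheory.Balaban1983to89.B6Ineq266Proof

open Finset
open B6RandomWalk (HasMajorant BlockSupp Triangle254 hasMajorant_mono)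
open B6Lemma21Repaired (Ineq261With Ineq263With)
open B6Eq250 (kOp gZero rOp aTerm bTerm)

/-! ## §1. (2.36)–(2.38) + (2.43) + (2.44) + Lemma 2.1 ⇒ (2.65), (2.66) over an abstract lattice -/

section Abstract

variable {g : B6.Geometry} {X : Type} {ι : Type*} [Fintype ι]

/-- **(2.37) + (2.43) ⇒ the majorant of `G′₀ = Σ_{□∈𝒟} h_□G′(□)h_□`** — the factor *"O(1)(L^jη)² Σ_{y″} e^{−δ₀(L^jη)⁻¹
|y−y″|}"* of (2.66): if every sandwiched term `h_□G′(□)h_□` (`B6Eq250.aTerm`) obeys the (2.43)-shape bound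
`|(h_□G′(□)h_□λ)(x)| ≤ A·P(y)e^{−δ₀d(y,y′)}|λ|` for `x ∈ B(y)`, `supp λ ⊂ B(y′)` and the cubes `□ ∈ cubesOf y′` meeting that
block, the cut-offs `h_□` annihilate the `λ` supported in blocks their cube does not meet, and at most `n₀` cubes meet a
block (p. 229: *"each cube being a sum of 2^d big blocks"*), then `G′₀` has the majorant `n₀A·P(y)e^{−δ₀d(y,y′)}`
(P(y) = (L^jη)² for the first entry). [cite: Balaban1984PropagatorsII, (2.37) p.229, (2.43) p.230, (2.66) p.234] -/
theorem hasMajorant_gZero_of_243 (blk : X → g.Site) (h gl : ι → Module.End ℝ (X → ℝ))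
    (cubesOf : g.Site → Finset ι) (P : g.Site → ℝ) {A δ₀ : ℝ} {n₀ : ℕ} (hA : 0 ≤ A) (hP : ∀ y, 0 ≤ P y)
    (h243 : ∀ b, ∀ i ∈ cubesOf b, ∀ (μ : X → ℝ) (B : ℝ), BlockSupp blk μ b B →
      ∀ x, |aTerm h gl i μ x| ≤ A * P (blk x) * Real.exp (-(δ₀ * g.dist (blk x) b)) * B)
    (hkill : ∀ b, ∀ i ∉ cubesOf b, ∀ (μ : X → ℝ) (B : ℝ), BlockSupp blk μ b B → h i μ = 0)
    (hcount : ∀ b, (cubesOf b).card ≤ n₀) :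
    HasMajorant blk (gZero h gl) (fun a b => n₀ * A * P a * Real.exp (-(δ₀ * g.dist a b))) := by
  have hkill' : ∀ b, ∀ i ∉ cubesOf b, ∀ (μ : X → ℝ) (B : ℝ), BlockSupp blk μ b B → aTerm h gl i μ = 0 := by
    intro b i hi μ B hμ
    rw [B6Eq250.aTerm_apply, Module.End.mul_apply, Module.End.mul_apply, hkill b i hi μ B hμ, map_zero,
      map_zero]
  have key := B6Ineq249Proof.hasMajorant_sum_of_244 blk (aTerm h gl) cubesOf
    (fun a b => P a * Real.exp (-(δ₀ * g.dist a b))) (θ := A) (n₀ := n₀) hA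
    (fun a b => mul_nonneg (hP a) (Real.exp_nonneg _))
    (fun b i hi μ B hμ x => by simpa only [mul_assoc] using h243 b i hi μ B hμ x) hkill' hcount
  rw [B6Eq250.gZero_eq_sum_aTerm]
  exact hasMajorant_mono blk key fun a b => le_of_eq (by simp only [mul_assoc])

/-- **(2.38) + (2.44) ⇒ the (2.51)/(2.64)-majorant of `R = Σ_{□∈𝒟} K(h_□)G′(□)h_□`** (`B6Eq250.rOp`), in the
`Module.End` vocabulary of the chain: majorant `n₀θ·e^{−δ₀d(y,y′)}` — this seat's `B6Ineq249Proof.hasMajorant251_of_244`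
summed over the cover. [cite: Balaban1984PropagatorsII, (2.44) p.230, (2.51) p.232, (2.64) p.234] -/
theorem hasMajorant_rOp_of_244 (blk : X → g.Site) (D : Module.End ℝ (X → ℝ)) (h gl : ι → Module.End ℝ (X → ℝ))
    (cubesOf : g.Site → Finset ι) {θ δ₀ : ℝ} {n₀ : ℕ} (hθ : 0 ≤ θ)
    (h244 : ∀ b, ∀ i ∈ cubesOf b, ∀ (μ : X → ℝ) (B : ℝ), BlockSupp blk μ b B →
      ∀ x, |bTerm D h gl i μ x| ≤ θ * Real.exp (-(δ₀ * g.dist (blk x) b)) * B)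
    (hkill : ∀ b, ∀ i ∉ cubesOf b, ∀ (μ : X → ℝ) (B : ℝ), BlockSupp blk μ b B → h i μ = 0)
    (hcount : ∀ b, (cubesOf b).card ≤ n₀) :
    HasMajorant blk (rOp D h gl) (fun a b => (n₀ * θ) * Real.exp (-(δ₀ * g.dist a b))) := by
  have hkill' : ∀ b, ∀ i ∉ cubesOf b, ∀ (μ : X → ℝ) (B : ℝ), BlockSupp blk μ b B → bTerm D h gl i μ = 0 := by
    intro b i hi μ B hμ
    rw [B6Eq250.bTerm_apply, Module.End.mul_apply, Module.End.mul_apply, hkill b i hi μ B hμ, map_zero,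
      map_zero]
  rw [B6Eq250.rOp_eq_sum_bTerm]
  exact B6Ineq249Proof.hasMajorant251_of_244 blk (bTerm D h gl) cubesOf hθ h244 hkill' hcount

/-- **(2.38) ⇒ `G′ = G′₀ + G′R`** (the first equality of (2.50), *"G′ = G′₀(I − R)⁻¹"*, as a fixed-point identity): in
any ring, the partition of unity (2.36) `Σ_□ h_□h_□ = I`, the local-inverse property `h_□Δ′_aG′(□)h_□ = h_□h_□` and
`G′Δ′_a = I` give it (`B6Eq250.left_inverse_mul_one_sub`). [cite: Balaban1984PropagatorsII, (2.38) p.229, (2.50) p.232] -/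
theorem fixedPoint_of_238 {𝔄 : Type*} [Ring 𝔄] {κ : Type*} [Fintype κ] (D Gp : 𝔄) (h g : κ → 𝔄)
    (hGD : Gp * D = 1) (hpart : ∑ i, h i * h i = 1) (hloc : ∀ i, h i * D * g i * h i = h i * h i) :
    Gp = gZero h g + Gp * rOp D h g := by
  have h1 := B6Eq250.left_inverse_mul_one_sub D Gp h g hGD hpart hloc
  rw [mul_sub, mul_one] at h1
  rw [← h1, sub_add_cancel]

/-- **(2.65)** *"Applying this inequality to the nth power of the operator R in (2.38) we have |(Rⁿλ)(x)| ≤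
(O(M⁻¹)c₁)ⁿe^{−½δ₀d(y,y′)}|λ|"*: with the (2.44)-majorants of the summands of `R` (constant `θ`, at most `n₀` cubes per
block), d(y,y) = 0 and (2.63)′ with constant `c`, the power `Rᴺ` has the majorant `(n₀θc)ᴺe^{−(1−α)δ₀d(y,y′)}` (α = ½ in
print). [cite: Balaban1984PropagatorsII, (2.65) p.234] -/
theorem pow_majorant265_of_244 (blk : X → g.Site) (D : Module.End ℝ (X → ℝ)) (h gl : ι → Module.End ℝ (X → ℝ))
    (cubesOf : g.Site → Finset ι) {θ δ₀ α c : ℝ} {n₀ : ℕ} (hθ : 0 ≤ θ)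
    (hrefl : ∀ y : g.Site, g.dist y y = 0) (h263 : Ineq263With c g δ₀ α)
    (h244 : ∀ b, ∀ i ∈ cubesOf b, ∀ (μ : X → ℝ) (B : ℝ), BlockSupp blk μ b B →
      ∀ x, |bTerm D h gl i μ x| ≤ θ * Real.exp (-(δ₀ * g.dist (blk x) b)) * B)
    (hkill : ∀ b, ∀ i ∉ cubesOf b, ∀ (μ : X → ℝ) (B : ℝ), BlockSupp blk μ b B → h i μ = 0)
    (hcount : ∀ b, (cubesOf b).card ≤ n₀) (N : ℕ) :
    HasMajorant blk (rOp D h gl ^ N)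
      (fun a b => (n₀ * θ * c) ^ N * Real.exp (-((1 - α) * δ₀ * g.dist a b))) :=
  B6Prop23Chain.majorant_pow_265W blk c δ₀ α (n₀ * θ) (by positivity) hrefl h263
    (hasMajorant_rOp_of_244 blk D h gl cubesOf hθ h244 hkill hcount) N

/-- **(2.66) — the first entry of Proposition 2.2 (2.67), assembled from the printed local inputs.**  Over an abstract
multiscale lattice `X` (block map `blk : X → 𝔅`), for `G′` a left inverse of `Δ′_a` (`G′Δ′_a = I`), a finite cover with
cut-offs `h_□` satisfying (2.36) `Σ_□ h_□h_□ = I` and local inverses `G′(□)` (`h_□Δ′_aG′(□)h_□ = h_□h_□`, p. 229): IF the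
terms `h_□G′(□)h_□` obey the (2.43)-shape bounds `A·P(y)e^{−δ₀d(y,y′)}` and the terms `K(h_□)G′(□)h_□` the (2.44)-shape
bounds `θ·e^{−δ₀d(y,y′)}` on the blocks met by `□` (≤ `n₀` cubes per block, `h_□` local), Lemma 2.1 holds in the
generic-constant form (2.61)′/(2.63)′ with constant `c` for the distance d ((2.54), d(y,y) = 0, d ≥ 0), and the located
smallness `n₀θ·c < 1` (*"M is sufficiently large"*) holds, THEN *"|(G′λ)(x)| ≤ Σ_n|(G′₀Rⁿλ)(x)| ≤ … ≤ O(1)(L^jη)²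
e^{−½δ₀d(y,y′)}|λ|"*: `G′` has the majorant `n₀A·c·(1 − n₀θc)⁻¹·P(y)·e^{−(1−α)δ₀d(y,y′)}` (the chain (2.52) ⇒ (2.64) ⇒
(2.65) ⇒ (2.66), `B6Prop23Chain.majorant_of_fixedPoint_266W`, fed by the three lemmas above).
[cite: Balaban1984PropagatorsII, (2.66)–(2.67) p.234] -/
theorem hasMajorant266_of_243_244 [Fintype X] [DecidableEq X] (blk : X → g.Site)
    (D Gp : Module.End ℝ (X → ℝ)) (h gl : ι → Module.End ℝ (X → ℝ)) (cubesOf : g.Site → Finset ι)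
    (P : g.Site → ℝ) {A θ δ₀ α c : ℝ} {n₀ : ℕ} (hA : 0 ≤ A) (hP : ∀ y, 0 ≤ P y) (hθ : 0 ≤ θ) (hc : 0 ≤ c)
    (hαδ : 0 ≤ (1 - α) * δ₀) (htri : Triangle254 g) (hrefl : ∀ y : g.Site, g.dist y y = 0)
    (hdnn : ∀ y y' : g.Site, 0 ≤ g.dist y y') (h261 : Ineq261With c g δ₀ α) (h263 : Ineq263With c g δ₀ α)
    (hsmall : n₀ * θ * c < 1) (hGD : Gp * D = 1) (hpart : ∑ i, h i * h i = 1)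
    (hloc : ∀ i, h i * D * gl i * h i = h i * h i)
    (h243 : ∀ b, ∀ i ∈ cubesOf b, ∀ (μ : X → ℝ) (B : ℝ), BlockSupp blk μ b B →
      ∀ x, |aTerm h gl i μ x| ≤ A * P (blk x) * Real.exp (-(δ₀ * g.dist (blk x) b)) * B)
    (h244 : ∀ b, ∀ i ∈ cubesOf b, ∀ (μ : X → ℝ) (B : ℝ), BlockSupp blk μ b B →
      ∀ x, |bTerm D h gl i μ x| ≤ θ * Real.exp (-(δ₀ * g.dist (blk x) b)) * B)
    (hkill : ∀ b, ∀ i ∉ cubesOf b, ∀ (μ : X → ℝ) (B : ℝ), BlockSupp blk μ b B → h i μ = 0)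
    (hcount : ∀ b, (cubesOf b).card ≤ n₀) :
    HasMajorant blk Gp
      (fun a b => n₀ * A * c * (1 - n₀ * θ * c)⁻¹ * P a * Real.exp (-((1 - α) * δ₀ * g.dist a b))) :=
  B6Prop23Chain.majorant_of_fixedPoint_266W blk c δ₀ α (n₀ * θ) (n₀ * A) P (by positivity) hP (by positivity) hc
    hαδ htri hrefl hdnn h261 h263 hsmall
    (hasMajorant_gZero_of_243 blk h gl cubesOf P hA hP h243 hkill hcount)
    (hasMajorant_rOp_of_244 blk D h gl cubesOf hθ h244 hkill hcount)
    (fixedPoint_of_238 D Gp h gl hGD hpart hloc)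

end Abstract

/-! ## §2. The model instance on the printed one-level cube cover (`B6CoverBox.boxGeo`): sites {0,…,nM}^d, cubes □_k of
side 2M centred on the M-lattice, h_k = Π_μ h((x_μ − k_μM)/M), d = the ℓ¹ lattice distance; an arbitrary fine lattice X
over the box with block map `blk` -/

section BoxModel

open B6CoverBox (boxGeo hprof bdist Kbox sum_hprof_sq card_filter_hprof_ne_zero_le hprof_nonneg hprof_le_one
  boxGeo_triangle boxGeo_ineq261With boxGeo_ineq263With Kbox_nonneg bdist_self bdist_nonneg)

variable {d n m j kk : ℕ} {L η Rr : ℝ} {X : Type}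

/-- **(2.36) as an operator identity on the model, any fine lattice**: cut-offs `h_k` acting on the functions on `X` as
multiplication by `h_k(y(x)) = Π_μ h((y(x)_μ − k_μM)/M)` satisfy `Σ_k h_kh_k = I` (from `B6CoverBox.sum_hprof_sq`, the
printed *"Σ_{□∈𝒟} h_□² = 1"*). [cite: Balaban1984PropagatorsII, (2.36) p.229] -/
theorem box_sum_h_mul_h (hm : 0 < m) (blk : X → (Fin d → Fin (n * m + 1)))
    (h : (Fin d → Fin (n + 1)) → Module.End ℝ (X → ℝ)) (hmul : ∀ k μ x, h k μ x = hprof m k (blk x) * μ x) :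
    ∑ k, h k * h k = 1 := by
  refine LinearMap.ext fun μ => funext fun x => ?_
  rw [LinearMap.sum_apply, Finset.sum_apply, Module.End.one_apply]
  simp_rw [Module.End.mul_apply, hmul]
  calc ∑ k : Fin d → Fin (n + 1), hprof m k (blk x) * (hprof m k (blk x) * μ x)
      = (∑ k : Fin d → Fin (n + 1), hprof m k (blk x) ^ 2) * μ x := by
        rw [Finset.sum_mul]
        exact Finset.sum_congr rfl fun k _ => by ring
    _ = μ x := by rw [sum_hprof_sq hm (blk x), one_mul]

/-- Locality of the cut-offs on the model: `h_k` annihilates every function supported in a block `b` at which the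
profile `h_k` vanishes. [cite: Balaban1984PropagatorsII, (2.36) p.229] -/
private theorem box_hkill (blk : X → (Fin d → Fin (n * m + 1)))
    (h : (Fin d → Fin (n + 1)) → Module.End ℝ (X → ℝ)) (hmul : ∀ k μ x, h k μ x = hprof m k (blk x) * μ x)
    (b : Fin d → Fin (n * m + 1)) (k : Fin d → Fin (n + 1))
    (hk : k ∉ Finset.univ.filter fun k : Fin d → Fin (n + 1) => hprof m k b ≠ 0) (μ : X → ℝ) (B : ℝ)
    (hμ : BlockSupp (g := boxGeo d n m j kk L η Rr) blk μ b B) : h k μ = 0 := by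
  have hkb : hprof m k b = 0 := by simpa using hk
  funext x
  rw [hmul, Pi.zero_apply]
  by_cases hx : blk x = b
  · rw [hx, hkb, zero_mul]
  · rw [hμ.off x hx, mul_zero]

/-- The cut-offs preserve block supports and sup bounds (0 ≤ h_k ≤ 1). [folklore] -/
private theorem blockSupp_h (blk : X → (Fin d → Fin (n * m + 1)))
    (h : (Fin d → Fin (n + 1)) → Module.End ℝ (X → ℝ)) (hmul : ∀ k μ x, h k μ x = hprof m k (blk x) * μ x)
    (k : Fin d → Fin (n + 1)) {μ : X → ℝ} {b : Fin d → Fin (n * m + 1)} {B : ℝ}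
    (hμ : BlockSupp (g := boxGeo d n m j kk L η Rr) blk μ b B) :
    BlockSupp (g := boxGeo d n m j kk L η Rr) blk (h k μ) b B := by
  refine ⟨hμ.nonneg, fun x hx => ?_, fun x hx => ?_⟩
  · rw [hmul, abs_mul, abs_of_nonneg (hprof_nonneg m k (blk x))]
    exact (mul_le_of_le_one_left (abs_nonneg _) (hprof_le_one m k (blk x))).trans (hμ.bound x hx)
  · rw [hmul, hμ.off x hx, mul_zero]

/-- **(2.65) on the printed cover**: if the summands `K(h_k)G′(□_k)h_k` of `R` obey the block-form (2.44) bounds with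
constant `θ` and rate `δ₀` in the ℓ¹ distance, then `Rᴺ` has the majorant `(2^dθK(αδ₀))ᴺe^{−(1−α)δ₀|y−y′|₁}` for every
`N` — the overlap number 2^d, d(y,y) = 0 and (2.63)′ with the constant K(αδ₀) = (2(1 − e^{−αδ₀})⁻¹)^d DISCHARGED
(0 < αδ₀, 0 ≤ δ₀, α ≤ 1). [cite: Balaban1984PropagatorsII, (2.65) p.234] -/
theorem box_pow_majorant265 (hm : 0 < m) {δ₀ α θ : ℝ} (hαδ₀ : 0 < α * δ₀) (hδ₀ : 0 ≤ δ₀) (hα : α ≤ 1)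
    (hθ : 0 ≤ θ) (blk : X → (Fin d → Fin (n * m + 1))) (D : Module.End ℝ (X → ℝ))
    (h gl : (Fin d → Fin (n + 1)) → Module.End ℝ (X → ℝ)) (hmul : ∀ k μ x, h k μ x = hprof m k (blk x) * μ x)
    (h244 : ∀ (k : Fin d → Fin (n + 1)) (b : Fin d → Fin (n * m + 1)) (μ : X → ℝ) (B : ℝ),
      BlockSupp (g := boxGeo d n m j kk L η Rr) blk μ b B → hprof m k b ≠ 0 →
        ∀ x, |bTerm D h gl k μ x| ≤ θ * Real.exp (-(δ₀ * bdist (blk x) b)) * B)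
    (N : ℕ) :
    HasMajorant (g := boxGeo d n m j kk L η Rr) blk (rOp D h gl ^ N)
      (fun a b => ((2 : ℝ) ^ d * θ * Kbox d (α * δ₀)) ^ N * Real.exp (-((1 - α) * δ₀ * bdist a b))) := by
  have key := pow_majorant265_of_244 (g := boxGeo d n m j kk L η Rr) blk D h gl
    (fun b => Finset.univ.filter fun k : Fin d → Fin (n + 1) => hprof m k b ≠ 0)
    (c := Kbox d (α * δ₀)) (n₀ := 2 ^ d) hθ (fun y => bdist_self y)
    (boxGeo_ineq263With d n m j kk L η Rr hαδ₀ hδ₀ hα)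
    (fun b k hk μ B hμ x => h244 k b μ B hμ (Finset.mem_filter.mp hk).2 x)
    (fun b k hk μ B hμ => box_hkill blk h hmul b k hk μ B hμ) (fun b => card_filter_hprof_ne_zero_le hm b) N
  simpa only [Nat.cast_pow, Nat.cast_ofNat] using key

/-- **(2.66) / THE FIRST ENTRY OF PROPOSITION 2.2 ON THE PRINTED COVER (one level, any fine lattice X over the box).**
With the cut-offs `h_k` of (2.36) acting as multiplication by `h_k ∘ blk`, `G′Δ′_a = I`, local inverses `G′(□_k)`
(`h_kΔ′_aG′(□_k)h_k = h_kh_k`), the block-form (2.43) bounds `|(G′(□_k)λ)(x)| ≤ A·P(y)e^{−δ₀|y−y′|₁}|λ|` and (2.44) bounds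
`|(K(h_k)G′(□_k)h_kλ)(x)| ≤ θe^{−δ₀|y−y′|₁}|λ|` (`x ∈ B(y)`, `supp λ ⊂ B(y′)`, cubes `□_k` meeting `B(y′)`), the rates
`0 < αδ₀`, `0 ≤ δ₀`, `α ≤ 1`, and *"M sufficiently large"* in the explicit form `2^dθK(αδ₀) < 1`: **`|(G′λ)(x)| ≤
2^dA·K(αδ₀)(1 − 2^dθK(αδ₀))⁻¹·P(y)·e^{−(1−α)δ₀|y−y′|₁}|λ|`** — every geometric hypothesis of §1 ((2.36), n₀ = 2^d, (2.54),
(2.61)′/(2.63)′ with K(αδ₀), d(y,y) = 0, d ≥ 0) DISCHARGED on the model, uniformly in the volume n.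
[cite: Balaban1984PropagatorsII, Prop. 2.2 (2.66)–(2.67) p.234] -/
theorem box_hasMajorant266_of_243_244 [Fintype X] [DecidableEq X] (hm : 0 < m) {δ₀ α θ A : ℝ}
    (hαδ₀ : 0 < α * δ₀) (hδ₀ : 0 ≤ δ₀) (hα : α ≤ 1) (hθ : 0 ≤ θ) (hA : 0 ≤ A)
    (blk : X → (Fin d → Fin (n * m + 1))) (P : (Fin d → Fin (n * m + 1)) → ℝ) (hP : ∀ y, 0 ≤ P y)
    (D Gp : Module.End ℝ (X → ℝ)) (h gl : (Fin d → Fin (n + 1)) → Module.End ℝ (X → ℝ))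
    (hmul : ∀ k μ x, h k μ x = hprof m k (blk x) * μ x) (hGD : Gp * D = 1)
    (hloc : ∀ k, h k * D * gl k * h k = h k * h k)
    (h243 : ∀ (k : Fin d → Fin (n + 1)) (b : Fin d → Fin (n * m + 1)) (μ : X → ℝ) (B : ℝ),
      BlockSupp (g := boxGeo d n m j kk L η Rr) blk μ b B → hprof m k b ≠ 0 →
        ∀ x, |gl k μ x| ≤ A * P (blk x) * Real.exp (-(δ₀ * bdist (blk x) b)) * B)
    (h244 : ∀ (k : Fin d → Fin (n + 1)) (b : Fin d → Fin (n * m + 1)) (μ : X → ℝ) (B : ℝ),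
      BlockSupp (g := boxGeo d n m j kk L η Rr) blk μ b B → hprof m k b ≠ 0 →
        ∀ x, |bTerm D h gl k μ x| ≤ θ * Real.exp (-(δ₀ * bdist (blk x) b)) * B)
    (hsmall : (2 : ℝ) ^ d * θ * Kbox d (α * δ₀) < 1) :
    HasMajorant (g := boxGeo d n m j kk L η Rr) blk Gp
      (fun a b => (2 : ℝ) ^ d * A * Kbox d (α * δ₀) * (1 - (2 : ℝ) ^ d * θ * Kbox d (α * δ₀))⁻¹ * P a *
        Real.exp (-((1 - α) * δ₀ * bdist a b))) := by
  have hsmall' : ((2 ^ d : ℕ) : ℝ) * θ * Kbox d (α * δ₀) < 1 := by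
    simpa only [Nat.cast_pow, Nat.cast_ofNat] using hsmall
  -- (2.43) for G′(□_k) ⇒ the same bound for the sandwiched term h_kG′(□_k)h_k (0 ≤ h_k ≤ 1, h_k local)
  have h243' : ∀ b, ∀ k ∈ (Finset.univ.filter fun k : Fin d → Fin (n + 1) => hprof m k b ≠ 0),
      ∀ (μ : X → ℝ) (B : ℝ), BlockSupp (g := boxGeo d n m j kk L η Rr) blk μ b B →
        ∀ x, |aTerm h gl k μ x| ≤
          A * P (blk x) * Real.exp (-(δ₀ * (boxGeo d n m j kk L η Rr).dist (blk x) b)) * B := by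
    intro b k hk μ B hμ x
    have hkb : hprof m k b ≠ 0 := (Finset.mem_filter.mp hk).2
    rw [B6Eq250.aTerm_apply, Module.End.mul_apply, Module.End.mul_apply, hmul, abs_mul,
      abs_of_nonneg (hprof_nonneg m k (blk x))]
    refine (mul_le_of_le_one_left (abs_nonneg _) (hprof_le_one m k (blk x))).trans ?_
    exact h243 k b (h k μ) B (blockSupp_h blk h hmul k hμ) hkb x
  have h244' : ∀ b, ∀ k ∈ (Finset.univ.filter fun k : Fin d → Fin (n + 1) => hprof m k b ≠ 0),
      ∀ (μ : X → ℝ) (B : ℝ), BlockSupp (g := boxGeo d n m j kk L η Rr) blk μ b B →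
        ∀ x, |bTerm D h gl k μ x| ≤ θ * Real.exp (-(δ₀ * (boxGeo d n m j kk L η Rr).dist (blk x) b)) * B :=
    fun b k hk μ B hμ x => h244 k b μ B hμ (Finset.mem_filter.mp hk).2 x
  have key := hasMajorant266_of_243_244 (g := boxGeo d n m j kk L η Rr) blk D Gp h gl
    (fun b => Finset.univ.filter fun k : Fin d → Fin (n + 1) => hprof m k b ≠ 0) P
    (c := Kbox d (α * δ₀)) (n₀ := 2 ^ d) hA hP hθ (Kbox_nonneg d hαδ₀) (mul_nonneg (by linarith) hδ₀)
    (boxGeo_triangle d n m j kk L η Rr) (fun y => bdist_self y) (fun y y' => bdist_nonneg y y')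
    (boxGeo_ineq261With d n m j kk L η Rr hαδ₀) (boxGeo_ineq263With d n m j kk L η Rr hαδ₀ hδ₀ hα) hsmall' hGD
    (box_sum_h_mul_h hm blk h hmul) hloc h243' h244' (fun b k hk μ B hμ => box_hkill blk h hmul b k hk μ B hμ)
    (fun b => card_filter_hprof_ne_zero_le hm b)
  simpa only [Nat.cast_pow, Nat.cast_ofNat] using key

/-- **The input `hG` of `B6CoverBox.prop23_assembled_box` DISCHARGED from (2.43)/(2.44)**: with the printed weight
P(y) = (L^jη)² (`(boxGeo …).len y ^ 2`, one level) the conclusion of `box_hasMajorant266_of_243_244` is verbatim the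
block majorant `B₁·(L^jη)²·e^{−δd(y,y′)}` of G′ that Proposition 2.3 consumes on this model (p. 238: *"This estimate
follows from the random walk representations (2.50) for the operators G′, G′(□̃)"*), with B₁ = 2^dAK(αδ₀)(1 − 2^dθK(αδ₀))⁻¹
and δ = (1 − α)δ₀. [cite: Balaban1984PropagatorsII, Prop. 2.2 (2.67) p.234; p.238 before (2.68)] -/
theorem box_hG_of_243_244 [Fintype X] [DecidableEq X] (hm : 0 < m) {δ₀ α θ A : ℝ} (hαδ₀ : 0 < α * δ₀)
    (hδ₀ : 0 ≤ δ₀) (hα : α ≤ 1) (hθ : 0 ≤ θ) (hA : 0 ≤ A) (blk : X → (Fin d → Fin (n * m + 1)))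
    (D Gp : Module.End ℝ (X → ℝ)) (h gl : (Fin d → Fin (n + 1)) → Module.End ℝ (X → ℝ))
    (hmul : ∀ k μ x, h k μ x = hprof m k (blk x) * μ x) (hGD : Gp * D = 1)
    (hloc : ∀ k, h k * D * gl k * h k = h k * h k)
    (h243 : ∀ (k : Fin d → Fin (n + 1)) (b : Fin d → Fin (n * m + 1)) (μ : X → ℝ) (B : ℝ),
      BlockSupp (g := boxGeo d n m j kk L η Rr) blk μ b B → hprof m k b ≠ 0 →
        ∀ x, |gl k μ x| ≤ A * (boxGeo d n m j kk L η Rr).len (blk x) ^ 2 *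
          Real.exp (-(δ₀ * (boxGeo d n m j kk L η Rr).dist (blk x) b)) * B)
    (h244 : ∀ (k : Fin d → Fin (n + 1)) (b : Fin d → Fin (n * m + 1)) (μ : X → ℝ) (B : ℝ),
      BlockSupp (g := boxGeo d n m j kk L η Rr) blk μ b B → hprof m k b ≠ 0 →
        ∀ x, |bTerm D h gl k μ x| ≤ θ * Real.exp (-(δ₀ * (boxGeo d n m j kk L η Rr).dist (blk x) b)) * B)
    (hsmall : (2 : ℝ) ^ d * θ * Kbox d (α * δ₀) < 1) :
    HasMajorant (g := boxGeo d n m j kk L η Rr) blk Gp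
      (fun a b => ((2 : ℝ) ^ d * A * Kbox d (α * δ₀) * (1 - (2 : ℝ) ^ d * θ * Kbox d (α * δ₀))⁻¹) *
        (boxGeo d n m j kk L η Rr).len a ^ 2 *
          Real.exp (-(((1 - α) * δ₀) * (boxGeo d n m j kk L η Rr).dist a b))) :=
  box_hasMajorant266_of_243_244 hm hαδ₀ hδ₀ hα hθ hA blk (fun a => (boxGeo d n m j kk L η Rr).len a ^ 2)
    (fun _ => sq_nonneg _) D Gp h gl hmul hGD hloc h243 h244 hsmall

/-- **(2.66) on the printed cover, blocks = sites, matrix form** (the level j = 0 of the cover, B⁰(y) = {y}, fine lattice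
= the unit lattice of block centres): if the cut-offs `h_k` act as multiplication by the profiles of (2.36), `G′Δ′_a = I`,
`h_kΔ′_aG′(□_k)h_k = h_kh_k`, and the matrix entries obey (2.43) `|G′(□_k)(x,y)| ≤ Ae^{−δ₀|x−y|₁}` and (2.44)
`|(K(h_k)G′(□_k)h_k)(x,y)| ≤ θe^{−δ₀|x−y|₁}`, then for `0 < αδ₀`, `0 ≤ δ₀`, `α ≤ 1` and `2^dθK(αδ₀) < 1`:
**`|G′(x,y)| ≤ 2^dA·K(αδ₀)(1 − 2^dθK(αδ₀))⁻¹·e^{−(1−α)δ₀|x−y|₁}`** — the exponential decay of the kernel of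
`G′ = Δ′_a⁻¹` on the model, uniformly in the volume. [cite: Balaban1984PropagatorsII, Prop. 2.2 (2.66)–(2.67) p.234] -/
theorem box_kernel266_of_243_244 (hm : 0 < m) {δ₀ α θ A : ℝ} (hαδ₀ : 0 < α * δ₀) (hδ₀ : 0 ≤ δ₀) (hα : α ≤ 1)
    (hθ : 0 ≤ θ) (hA : 0 ≤ A) (D Gp : Module.End ℝ ((Fin d → Fin (n * m + 1)) → ℝ))
    (h gl : (Fin d → Fin (n + 1)) → Module.End ℝ ((Fin d → Fin (n * m + 1)) → ℝ))
    (hmul : ∀ k μ x, h k μ x = hprof m k x * μ x) (hGD : Gp * D = 1)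
    (hloc : ∀ k, h k * D * gl k * h k = h k * h k)
    (h243 : ∀ k y x, |gl k (Pi.single y 1) x| ≤ A * Real.exp (-(δ₀ * bdist x y)))
    (h244 : ∀ k y x, |bTerm D h gl k (Pi.single y 1) x| ≤ θ * Real.exp (-(δ₀ * bdist x y)))
    (hsmall : (2 : ℝ) ^ d * θ * Kbox d (α * δ₀) < 1) (x y : Fin d → Fin (n * m + 1)) :
    |Gp (Pi.single y 1) x| ≤ (2 : ℝ) ^ d * A * Kbox d (α * δ₀) * (1 - (2 : ℝ) ^ d * θ * Kbox d (α * δ₀))⁻¹ *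
      Real.exp (-((1 - α) * δ₀ * bdist x y)) := by
  -- the dictionary "block form (blocks = sites) ↔ matrix entries" of `B6Prop23Chain`
  have hblk : ∀ (T : Module.End ℝ ((Fin d → Fin (n * m + 1)) → ℝ))
      (F : (Fin d → Fin (n * m + 1)) → (Fin d → Fin (n * m + 1)) → ℝ),
      (∀ y x, |T (Pi.single y 1) x| ≤ F x y) →
        ∀ (b : Fin d → Fin (n * m + 1)) (μ : (Fin d → Fin (n * m + 1)) → ℝ) (B : ℝ),
          BlockSupp (g := boxGeo d n m 0 0 0 0 0) id μ b B → ∀ x, |T μ x| ≤ F x b * B := by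
    intro T F hT b μ B hμ x
    exact (B6Prop23Chain.hasMajorant_id_iff (g := boxGeo d n m 0 0 0 0 0) T F).mpr (fun a b => hT b a) b μ B hμ x
  have key := box_hasMajorant266_of_243_244 (j := 0) (kk := 0) (L := 0) (η := 0) (Rr := 0) hm hαδ₀ hδ₀ hα hθ hA
    (id : (Fin d → Fin (n * m + 1)) → (Fin d → Fin (n * m + 1))) (fun _ => (1 : ℝ)) (fun _ => zero_le_one) D Gp h gl
    hmul hGD hloc
    (fun k b μ B hμ _ x => by
      simpa only [mul_one, id_eq] using
        hblk (gl k) (fun a b => A * Real.exp (-(δ₀ * bdist a b))) (fun y x => h243 k y x) b μ B hμ x)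
    (fun k b μ B hμ _ x => hblk (bTerm D h gl k) (fun a b => θ * Real.exp (-(δ₀ * bdist a b)))
      (fun y x => h244 k y x) b μ B hμ x)
    hsmall
  have := key y (Pi.single y 1) 1 (B6Prop23Chain.blockSupp_single (g := boxGeo d n m 0 0 0 0 0) y) x
  simpa only [mul_one, id_eq] using this

end BoxModel


end Literature.MathematicalPhysics.QuantumFieldTheory.Balaban1983to89.B6Ineq266Proof
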